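import Summits.HodgeConjecture.HodgeConjecture.Theorems.LinearSystemTorelliTranscendentalOrSupportedStubOfMiddleOfHodgeEffectiveAbstract

/-!
THE COSTUME CERTIFICATE for crux stmt-HodgeConjecture-1081 `LinearSystemTorelli.MiddleDivisorSupport` (strategist r1).
With the landed Theorems module in scope, BOTH directions are one term: the crux is the sub-problem Statement
`_root_.HodgeConjecture` in divisor-support costume (Thomas 2005 Thm 1 on the tree's carriers), unconditionally
(`#print axioms` requested from the farm: expected {propext, Classical.choice, Quot.sound}).
-/

namespace Summit.HodgeConjecture.HodgeConjecture.Cruxes.MiddleDivisorSupport.StrategistR1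

open Summit.HodgeConjecture.HodgeConjecture

/-- C → S by name. -/
theorem crux_implies_summit :
    Theses.LinearSystemTorelli.MiddleDivisorSupport → _root_.HodgeConjecture :=
  Theorems.middleDivisorSupport_iff_hodgeConjecture.1

/-- S → C by name. -/
theorem summit_implies_crux :
    _root_.HodgeConjecture → Theses.LinearSystemTorelli.MiddleDivisorSupport :=
  Theorems.middleDivisorSupport_iff_hodgeConjecture.2

/-- C ↔ S. -/
theorem crux_iff_summit :
    Theses.LinearSystemTorelli.MiddleDivisorSupport ↔ _root_.HodgeConjecture :=
  Theorems.middleDivisorSupport_iff_hodgeConjecture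

/-- The same cheap BC2 battery now SUCCEEDS (library search sees the landed iff). -/
example : Theses.LinearSystemTorelli.MiddleDivisorSupport → _root_.HodgeConjecture := by
  first | exact? | aesop

end Summit.HodgeConjecture.HodgeConjecture.Cruxes.MiddleDivisorSupport.StrategistR1
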